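import Literature.AnabelianGeometry.SemiGraphs.PSCSeparatingCoveringsThreeChainUnmarkedFirstVertices
import Literature.AnabelianGeometry.SemiGraphs.PSCSeparatingCoveringsThreeChainUnmarkedFirstCombEdges
import Literature.AnabelianGeometry.SemiGraphs.PSCUnrVerticialSeparatingCoveringsThreeChainOfNe
import Literature.AnabelianGeometry.SemiGraphs.PSCSeparatingCoveringsThreeChainAll
import HarnessLib

/-!
# [CombGC] Prop. 1.2 IN FULL and the separating coverings (rows F-2829, F-2830, F-0438, F-0459) at THREE-COMPONENT «COMB» CHAINS (unmarked first component carrying all the handles)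

Mochizuki, *A combinatorial version of the Grothendieck conjecture*, Tohoku Math. J. **59** (2007)
[CombGC], Proposition 1.2 (i)(ii) p. 8 and its PROOF p. 9 [cite: MochizukiCombGC2007, Prop 1.2 pp.8-9]: the
separating-coverings step typed LEVEL-WISE as `PSCDatum.SeparatingCoverings` / `SeparatingCoveringsHolds Ω`
(abc-iut-w4-d081, row P12-L01; abc-iut FACT-LIST rows F-2829 / F-2830) and the printed statements
`OpenInterDeterminesComponentHolds Ω` (F-0459), `CommensurableTerminalityHolds Ω` (F-0438) — schemata whose
universal closures are refuted as typed; the instance forms at genuine carriers are the content.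

PROOF-ONLY file (abc-iut-f-166 gen 6, row «UNMARKED-FIRST-CHAIN», file 6 = comb capstone; 0 definitions).
CAPSTONE at abc-iut-f-164's three-component chain shape whose UNMARKED first component carries ALL the handles
(`g₀ = g₁ = g ≥ 1`, `s₂ = r`, `C_mid` and `C₁` rational, `2 ≤ s₁ < r`) — the sub-corner of the unmarked-first
stratum outside abc-iut-f-060's node twist, closed by file 5's boundary-node argument.

* `separatingCoverings_of_threeChain_unmarkedFirst_comb` — **F-2829**, all three conjuncts
  (`verticialSeparatingCoverings_of_threeChain_unmarkedFirst`, `edgeLikeSeparatingCoverings_of_threeChain_unmarkedFirst_comb`,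
  `unrVerticialSeparatingCoverings_of_threeChain_unmarkedFirst`);
* `prop12_of_threeChain_unmarkedFirst_comb` — all five typed clauses of Prop. 1.2 (i)(ii) there;
* `exists_threeChainUnmarkedFirstCombOrigin_prop12_holds_all` — **F-2830 ∧ F-0438 ∧ F-0459 at the INHABITED
  origin of ALL comb chains**, inhabited by the chain `Γ_{2,3}` of genera `(2,0,0)` with no marked point on `C₀`,
  one on `C_mid`, two on `C₁` (abc-iut-f-164's `exists_threeChainDatum`).

Instance forms at data of the shape of genuine stable curves: consistency evidence for the typed schemata,
not the printed theorem for all pointed stable curves.  Nothing here takes a side on [IUTchIII] Cor. 3.12.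
-/



noncomputable section

namespace Literature.AnabelianGeometry.SemiGraphs

namespace PSCDatum

open scoped Pointwise
open Literature.GroupTheory.CombinatorialGroupTheory
open Literature.GroupTheory.CombinatorialGroupTheory.PuncturedSurfaceGroup (cuspInertia)
open SemiGraphOfAnabelioids (IsProSigmaCompletion)

section Datum

variable {P : Type} [Group P] [TopologicalSpace P] [IsTopologicalGroup P]
variable [CompactSpace P] [TotallyDisconnectedSpace P] {Sigma : Set ℕ} {g r : ℕ}

/-- **Row F-2829 `SeparatingCoverings` — all three conjuncts — at EVERY three-component «comb» chain datum**
(`g₀ = g₁ = g ≥ 1`, `s₂ = r`, `2 ≤ s₁ < r`, genera pinned).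
[cite: MochizukiCombGC2007, Prop 1.2 proof p.9] -/
theorem separatingCoverings_of_threeChain_unmarkedFirst_comb (hne : Sigma.Nonempty)
    (hprime : ∀ p ∈ Sigma, p.Prime) (ι : PuncturedSurfaceGroup g r →* P)
    (hι : IsProSigmaCompletion Sigma ι) (G : PSCDatum P) {g₀ g₁ s₁ s₂ : ℕ} (hg₀g : g₀ = g) (hg₁g : g₁ = g)
    (hg1 : 1 ≤ g) (hs₁ : 2 ≤ s₁) (hs₁r : s₁ < r) (hs₂ : s₂ = r) (e : G.graph.C ≃ Fin r)
    (hC : ∀ c', G.cuspGp c' = ((cuspInertia (g := g) (e c')).map ι).topologicalClosure)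
    (v₀ vm v₁ : G.graph.V) (hV : ∀ w, w = v₀ ∨ w = vm ∨ w = v₁) (εA η : PuncturedSurfaceGroup g r)
    (hεA : εA = ((List.finRange r).map fun j : Fin r =>
          if s₂ ≤ (j : ℕ) then PuncturedSurfaceGroup.c (g := g) j else 1).prod *
        ((List.finRange g).map fun i : Fin g => if (i : ℕ) < g₀ then
          PuncturedSurfaceGroup.a (r := r) i * PuncturedSurfaceGroup.b i *
            (PuncturedSurfaceGroup.a i)⁻¹ * (PuncturedSurfaceGroup.b i)⁻¹ else 1).prod)
    (hη : η = ((List.finRange r).map fun j : Fin r =>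
          if s₁ ≤ (j : ℕ) then PuncturedSurfaceGroup.c (g := g) j else 1).prod *
        ((List.finRange g).map fun i : Fin g => if (i : ℕ) < g₁ then
          PuncturedSurfaceGroup.a (r := r) i * PuncturedSurfaceGroup.b i *
            (PuncturedSurfaceGroup.a i)⁻¹ * (PuncturedSurfaceGroup.b i)⁻¹ else 1).prod)
    (hV₀ : G.vertGp v₀ = ((Subgroup.closure {x : PuncturedSurfaceGroup g r |
        (∃ i : Fin g, (i : ℕ) < g₀ ∧ (x = PuncturedSurfaceGroup.a i ∨ x = PuncturedSurfaceGroup.b i)) ∨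
        ∃ j : Fin r, s₂ ≤ (j : ℕ) ∧ x = PuncturedSurfaceGroup.c j}).map ι).topologicalClosure)
    (hVm : G.vertGp vm = ((Subgroup.closure {x : PuncturedSurfaceGroup g r |
        (∃ i : Fin g, (g₀ ≤ (i : ℕ) ∧ (i : ℕ) < g₁) ∧
          (x = PuncturedSurfaceGroup.a i ∨ x = PuncturedSurfaceGroup.b i)) ∨
        (∃ j : Fin r, (s₁ ≤ (j : ℕ) ∧ (j : ℕ) < s₂) ∧ x = PuncturedSurfaceGroup.c j) ∨
        x = εA ∨ x = η}).map ι).topologicalClosure)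
    (hV₁ : G.vertGp v₁ = ((Subgroup.closure {x : PuncturedSurfaceGroup g r |
        (∃ i : Fin g, g₁ ≤ (i : ℕ) ∧ (x = PuncturedSurfaceGroup.a i ∨ x = PuncturedSurfaceGroup.b i)) ∨
        (∃ j : Fin r, (j : ℕ) < s₁ ∧ x = PuncturedSurfaceGroup.c j) ∨ x = η}).map ι).topologicalClosure)
    (nA nB : G.graph.N) (hN : ∀ n, n = nA ∨ n = nB)
    (hEA : G.nodeGp nA = ((Subgroup.zpowers εA).map ι).topologicalClosure)
    (hEB : G.nodeGp nB = ((Subgroup.zpowers η).map ι).topologicalClosure)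
    (hgen₀ : G.genus v₀ = g₀) (hgenm : G.genus vm = g₁ - g₀) (hgen₁ : G.genus v₁ = g - g₁) :
    G.SeparatingCoverings :=
  ⟨G.verticialSeparatingCoverings_of_threeChain_unmarkedFirst hne hprime ι hι (by omega) (by omega) (by omega)
      (by omega) hs₁r hs₂ (Or.inr hs₁) v₀ vm v₁ hV εA η hεA hη hV₀ hVm hV₁,
    G.edgeLikeSeparatingCoverings_of_threeChain_unmarkedFirst_comb hne hprime ι hι hg₀g hg₁g hg1 hs₁ hs₁r hs₂ e hC
      εA η hεA hη nA nB hN hEA hEB,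
    G.unrVerticialSeparatingCoverings_of_threeChain_unmarkedFirst hne hprime ι hι (by omega) (by omega) (by omega)
      (by omega) hs₁r e hC v₀ vm v₁ hV εA η hεA hη hV₀ hVm hV₁ nA nB hN hEA hEB hgen₀ hgenm hgen₁⟩

/-- **[CombGC] Prop. 1.2 (i) and (ii) IN FULL at EVERY three-component «comb» chain datum**
(abc-iut-w5-d183's `prop12_of_separating` applied to F-2829 above).
[cite: MochizukiCombGC2007, Prop 1.2 pp.8-9] -/
theorem prop12_of_threeChain_unmarkedFirst_comb (hne : Sigma.Nonempty)
    (hprime : ∀ p ∈ Sigma, p.Prime) (ι : PuncturedSurfaceGroup g r →* P)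
    (hι : IsProSigmaCompletion Sigma ι) (G : PSCDatum P) {g₀ g₁ s₁ s₂ : ℕ} (hg₀g : g₀ = g) (hg₁g : g₁ = g)
    (hg1 : 1 ≤ g) (hs₁ : 2 ≤ s₁) (hs₁r : s₁ < r) (hs₂ : s₂ = r) (e : G.graph.C ≃ Fin r)
    (hC : ∀ c', G.cuspGp c' = ((cuspInertia (g := g) (e c')).map ι).topologicalClosure)
    (v₀ vm v₁ : G.graph.V) (hV : ∀ w, w = v₀ ∨ w = vm ∨ w = v₁) (εA η : PuncturedSurfaceGroup g r)
    (hεA : εA = ((List.finRange r).map fun j : Fin r =>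
          if s₂ ≤ (j : ℕ) then PuncturedSurfaceGroup.c (g := g) j else 1).prod *
        ((List.finRange g).map fun i : Fin g => if (i : ℕ) < g₀ then
          PuncturedSurfaceGroup.a (r := r) i * PuncturedSurfaceGroup.b i *
            (PuncturedSurfaceGroup.a i)⁻¹ * (PuncturedSurfaceGroup.b i)⁻¹ else 1).prod)
    (hη : η = ((List.finRange r).map fun j : Fin r =>
          if s₁ ≤ (j : ℕ) then PuncturedSurfaceGroup.c (g := g) j else 1).prod *
        ((List.finRange g).map fun i : Fin g => if (i : ℕ) < g₁ then
          PuncturedSurfaceGroup.a (r := r) i * PuncturedSurfaceGroup.b i *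
            (PuncturedSurfaceGroup.a i)⁻¹ * (PuncturedSurfaceGroup.b i)⁻¹ else 1).prod)
    (hV₀ : G.vertGp v₀ = ((Subgroup.closure {x : PuncturedSurfaceGroup g r |
        (∃ i : Fin g, (i : ℕ) < g₀ ∧ (x = PuncturedSurfaceGroup.a i ∨ x = PuncturedSurfaceGroup.b i)) ∨
        ∃ j : Fin r, s₂ ≤ (j : ℕ) ∧ x = PuncturedSurfaceGroup.c j}).map ι).topologicalClosure)
    (hVm : G.vertGp vm = ((Subgroup.closure {x : PuncturedSurfaceGroup g r |
        (∃ i : Fin g, (g₀ ≤ (i : ℕ) ∧ (i : ℕ) < g₁) ∧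
          (x = PuncturedSurfaceGroup.a i ∨ x = PuncturedSurfaceGroup.b i)) ∨
        (∃ j : Fin r, (s₁ ≤ (j : ℕ) ∧ (j : ℕ) < s₂) ∧ x = PuncturedSurfaceGroup.c j) ∨
        x = εA ∨ x = η}).map ι).topologicalClosure)
    (hV₁ : G.vertGp v₁ = ((Subgroup.closure {x : PuncturedSurfaceGroup g r |
        (∃ i : Fin g, g₁ ≤ (i : ℕ) ∧ (x = PuncturedSurfaceGroup.a i ∨ x = PuncturedSurfaceGroup.b i)) ∨
        (∃ j : Fin r, (j : ℕ) < s₁ ∧ x = PuncturedSurfaceGroup.c j) ∨ x = η}).map ι).topologicalClosure)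
    (nA nB : G.graph.N) (hN : ∀ n, n = nA ∨ n = nB)
    (hEA : G.nodeGp nA = ((Subgroup.zpowers εA).map ι).topologicalClosure)
    (hEB : G.nodeGp nB = ((Subgroup.zpowers η).map ι).topologicalClosure)
    (hgen₀ : G.genus v₀ = g₀) (hgenm : G.genus vm = g₁ - g₀) (hgen₁ : G.genus v₁ = g - g₁) :
    (G.VerticialOpenInterDeterminesVertex ∧ G.EdgeLikeOpenInterDeterminesEdge ∧
      G.UnrVerticialOpenInterDeterminesVertex) ∧
    (G.VerticialEdgeLikeCommensurablyTerminal ∧ G.UnrVerticialCommensurablyTerminal) :=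
  G.prop12_of_separating (G.separatingCoverings_of_threeChain_unmarkedFirst_comb hne hprime ι hι hg₀g hg₁g hg1 hs₁
    hs₁r hs₂ e hC v₀ vm v₁ hV εA η hεA hη hV₀ hVm hV₁ nA nB hN hEA hEB hgen₀ hgenm hgen₁)

end Datum

/-! ### Rows F-2830, F-0438, F-0459 at the origin of all comb three-chains -/

/-- **Row F-2830 `SeparatingCoveringsHolds Ω`, F-0438 `CommensurableTerminalityHolds Ω` (both clauses) and
F-0459 `OpenInterDeterminesComponentHolds Ω` at the INHABITED origin of ALL three-component «comb» chain data**
(`g₀ = g₁ = g ≥ 1`, `s₂ = r`, `2 ≤ s₁ < r`, genus pins; profinite pro-`Σ` completions in `Type`); inhabited by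
the chain `Γ_{2,3}` of genera `(2,0,0)` with no marked point on `C₀`, one on `C_mid`, two on `C₁`. [cite: MochizukiCombGC2007, Prop 1.2 pp.8-9] -/
theorem exists_threeChainUnmarkedFirstCombOrigin_prop12_holds_all (Sigma : Set ℕ) (hne : Sigma.Nonempty)
    (hprime : ∀ p ∈ Sigma, p.Prime) :
    ∃ Ω : PSCOrigin.{0},
      (∃ (Q : ProfiniteGrp.{0}) (G : PSCDatum Q), Ω.IsOfPSCType G ∧ G.Sigma = Sigma ∧
        G.graph.i = 3 ∧ G.graph.n = 2 ∧ G.graph.r = 3 ∧ ∃ v₀ vm v₁ : G.graph.V, (∀ w, w = v₀ ∨ w = vm ∨ w = v₁) ∧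
          G.genus v₀ = 2 ∧ G.genus vm = 0 ∧ G.genus v₁ = 0) ∧
      SeparatingCoveringsHolds Ω ∧ CommensurableTerminalityHolds Ω ∧ OpenInterDeterminesComponentHolds Ω := by
  classical
  let Ω : PSCOrigin.{0} :=
    ⟨fun {Q} _ _ G => ∃ (_ : IsTopologicalGroup Q), CompactSpace Q ∧ T2Space Q ∧ TotallyDisconnectedSpace Q ∧
      ∃ (S : Set ℕ) (g r g₀ g₁ s₁ s₂ : ℕ) (ι : PuncturedSurfaceGroup g r →* Q) (e : G.graph.C ≃ Fin r)
        (v₀ vm v₁ : G.graph.V) (nA nB : G.graph.N) (εA η : PuncturedSurfaceGroup g r),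
        S.Nonempty ∧ (∀ p ∈ S, p.Prime) ∧ IsProSigmaCompletion S ι ∧ g₀ = g ∧ g₁ = g ∧ 1 ≤ g ∧
        2 ≤ s₁ ∧ s₁ < r ∧ s₂ = r ∧
        (∀ c, G.cuspGp c =
          ((PuncturedSurfaceGroup.cuspInertia (g := g) (e c)).map ι).topologicalClosure) ∧
        (∀ w, w = v₀ ∨ w = vm ∨ w = v₁) ∧ (∀ n, n = nA ∨ n = nB) ∧
        εA = ((List.finRange r).map fun j : Fin r =>
            if s₂ ≤ (j : ℕ) then PuncturedSurfaceGroup.c (g := g) j else 1).prod *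
          ((List.finRange g).map fun i : Fin g => if (i : ℕ) < g₀ then
            PuncturedSurfaceGroup.a (r := r) i * PuncturedSurfaceGroup.b i *
              (PuncturedSurfaceGroup.a i)⁻¹ * (PuncturedSurfaceGroup.b i)⁻¹ else 1).prod ∧
        η = ((List.finRange r).map fun j : Fin r =>
            if s₁ ≤ (j : ℕ) then PuncturedSurfaceGroup.c (g := g) j else 1).prod *
          ((List.finRange g).map fun i : Fin g => if (i : ℕ) < g₁ then
            PuncturedSurfaceGroup.a (r := r) i * PuncturedSurfaceGroup.b i *
              (PuncturedSurfaceGroup.a i)⁻¹ * (PuncturedSurfaceGroup.b i)⁻¹ else 1).prod ∧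
        G.vertGp v₀ = ((Subgroup.closure {x : PuncturedSurfaceGroup g r |
          (∃ i : Fin g, (i : ℕ) < g₀ ∧ (x = PuncturedSurfaceGroup.a i ∨ x = PuncturedSurfaceGroup.b i)) ∨
          ∃ j : Fin r, s₂ ≤ (j : ℕ) ∧ x = PuncturedSurfaceGroup.c j}).map ι).topologicalClosure ∧
        G.vertGp vm = ((Subgroup.closure {x : PuncturedSurfaceGroup g r |
          (∃ i : Fin g, (g₀ ≤ (i : ℕ) ∧ (i : ℕ) < g₁) ∧
            (x = PuncturedSurfaceGroup.a i ∨ x = PuncturedSurfaceGroup.b i)) ∨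
          (∃ j : Fin r, (s₁ ≤ (j : ℕ) ∧ (j : ℕ) < s₂) ∧ x = PuncturedSurfaceGroup.c j) ∨
          x = εA ∨ x = η}).map ι).topologicalClosure ∧
        G.vertGp v₁ = ((Subgroup.closure {x : PuncturedSurfaceGroup g r |
          (∃ i : Fin g, g₁ ≤ (i : ℕ) ∧ (x = PuncturedSurfaceGroup.a i ∨ x = PuncturedSurfaceGroup.b i)) ∨
          (∃ j : Fin r, (j : ℕ) < s₁ ∧ x = PuncturedSurfaceGroup.c j) ∨ x = η}).map ι).topologicalClosure ∧
        G.nodeGp nA = ((Subgroup.zpowers εA).map ι).topologicalClosure ∧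
        G.nodeGp nB = ((Subgroup.zpowers η).map ι).topologicalClosure ∧
        G.genus v₀ = g₀ ∧ G.genus vm = g₁ - g₀ ∧ G.genus v₁ = g - g₁⟩
  have hsep : SeparatingCoveringsHolds Ω := by
    intro Q _ _ _ G hG
    obtain ⟨_, hc, ht, hd, S, g, r, g₀, g₁, s₁, s₂, ι, e, v₀, vm, v₁, nA, nB, εA, η, hSne, hSp, hι, hg₀g, hg₁g,
      hg1, hs₁, hs₁r, hs₂, hC, hV, hN, hεA, hη, hV₀, hVm, hV₁, hEA, hEB, hgen₀, hgenm, hgen₁⟩ := hG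
    haveI := hc
    haveI := hd
    exact G.separatingCoverings_of_threeChain_unmarkedFirst_comb hSne hSp ι hι hg₀g hg₁g hg1 hs₁ hs₁r hs₂ e hC v₀ vm
      v₁ hV εA η hεA hη hV₀ hVm hV₁ nA nB hN hEA hEB hgen₀ hgenm hgen₁
  have hprof : ∀ ⦃Q : Type⦄ [Group Q] [TopologicalSpace Q] [IsTopologicalGroup Q] (G : PSCDatum Q),
      Ω.IsOfPSCType G → CompactSpace Q ∧ TotallyDisconnectedSpace Q := fun Q _ _ _ G hG => by
    obtain ⟨_, hc, -, hd, -⟩ := hG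
    exact ⟨hc, hd⟩
  refine ⟨Ω, ?_, hsep, commensurableTerminalityHolds_of_separating Ω hsep hprof,
    openInterDeterminesComponentHolds_of_separating Ω hsep hprof⟩
  -- the member: `Γ_{2,3}`, genera `(2,0,0)`, marked points: none on `C₀`, `c₂` on `C_mid`, `c₀, c₁` on `C₁`
  obtain ⟨Q, ι, G, e, v₀, vm, v₁, nA, nB, εA, η, hι, hS, hi, hn, hr, hC, hV, hN, hεA, hη, hV₀, hVm, hV₁,
    hEA, hEB, hgen₀, hgenm, hgen₁, -, -⟩ := exists_threeChainDatum Sigma hne hprime 2 3 2 2 2 3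
  refine ⟨Q, G, ?_, hS, hi, hn, hr, v₀, vm, v₁, hV, hgen₀, hgenm, hgen₁⟩
  exact ⟨inferInstance, inferInstance, inferInstance, inferInstance, Sigma, 2, 3, 2, 2, 2, 3, ι, e, v₀, vm, v₁,
    nA, nB, εA, η, hne, hprime, hι, rfl, rfl, by norm_num, le_rfl, by norm_num, rfl, hC, hV, hN, hεA, hη, hV₀,
    hVm, hV₁, hEA, hEB, hgen₀, hgenm, hgen₁⟩

end PSCDatum

end Literature.AnabelianGeometry.SemiGraphs

end
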